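import Mathlib
import Summits.Ventures.PercRepro2.HCov
import Summits.Ventures.PercRepro2.BHKAvoid
import Summits.Ventures.PercRepro2.BHKEvents
import Summits.Ventures.PercRepro2.CrossClusterFunctional
import Summits.Ventures.PercRepro2.RootLeafUHalf
import Summits.Ventures.PercRepro2.RootLeafUMixK
import Summits.Ventures.PercRepro2.RootLeafUMixKA
import Summits.Ventures.PercRepro2.RootLeafUMixHb
import Summits.Ventures.PercRepro2.RootLeafUMixHbL
import Summits.Ventures.PercRepro2.RootLeafUMixHbLThm
import Summits.Ventures.PercRepro2.RootLeafUOu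
import Summits.Ventures.PercRepro2.RootLeafUMasterIdentity
import Summits.Ventures.PercRepro2.RootLeafULSide
import Summits.Ventures.PercRepro2.RootLeafUKSideSup

/-!
# The `o ∈ L` half of the second root-leaf coefficient: the mirror of RootLeafUKSideSup — `0 ≤ M·δ + (b)_L` for ANY
constant `M` dominating the residual connection `g_L(K) = P_{G ∖ K}(u ↔ b)` on the clusters `K = C(a₂) ∋ c`, and the
slack class `(2β·M − (κ − α))·δ ≤ P(R,oL)·(OU) + 2β·(c)_L` (blind cell PercRepro2, p4 g27; S3 (G4-u) item (ap), L side)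

The roles of the roots swapped (`R = {u ↮ {a₂, c}}`, `W = P(R) = D + t`, the explored cluster `K = C(a₂)`,
`g_L(K) = P(b ∈ C(u) in G ∖ K)`, `hbL = P(u ↔ b)`): p4 g14's `MixL.hbL_delta_add_bracket_nonneg` proves
`0 ≤ hbL·δ + (b)_L + (c)_L` with the antitone `φ_L(K) = hbL·1_{c∉K} + g_L(K)·1_{c∈K}`, where hbL enters only through
`g_L(K) ≤ hbL`.  Here, as on the K side:

* **`F1LM_nonneg`**: `0 ≤ M·δ + (b)_L` for every `M ≥ 0` with `g_L(C(a₂)(ω)) ≤ M` whenever `c ∈ C(a₂)(ω)` — the SHARP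
  bound (no `(c)_L` slack), by `KSup.bhk_cross_functional_avoid_clusterAnti` for the functional `φ_{L,M}` antitone along
  nested clusters of `a₂`, `MixL.J0L_eq` / `MixL.JL_le` (exploration of `K`, Harris in `G ∖ K`);
  `δ = t·P(PD,oL) − D·P(T,oL)`, `(b)_L = W·P(T,oL,bL) − P(R,oL)·P(T,bL)`;
* with `LSide.W_mul_T2oL_eq` (`W·T2oL = P(R,oL)·(OU) + (κ − α)·δ + 2β·(b)_L + 2β·(c)_L`):
  **`W_mul_T2oL_ge`**: `W·T2oL ≥ P(R,oL)·(OU) + ((κ − α) − 2β·M)·δ + 2β·(c)_L`, hence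
  **`T2oL_nonneg_of_slack_class_M`**: `0 ≤ T2oL` whenever `(2β·M − (κ − α))·δ ≤ P(R,oL)·(OU) + 2β·(c)_L`, and
  **`T2oL_nonneg_of_slack_class_gac`** with `M = g_L({a₂, c}) = P_{G − {a₂, c}}(u ↔ b)` (`delClusterProb` at `{a₂, c}`);
  the class `(2β·hbL − (κ − α))·δ ≤ P(R,oL)·(OU)` of `MixL.T2oL_nonneg_of_classL_hb` is contained in it (`g_L({a₂,c}) ≤ hbL`,
  `(c)_L ≥ 0`).

On the census of this seat (random instances n = 5–7, uniform and extreme weights, 900 instances) the slack class with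
`M = g_L({a₂, c})` fails on 12 instances (the `hbL` slack class on 28; the class of `T2oL_nonneg_of_classL_hb` on 46).
No definitions; standard axioms.
-/

namespace Summit.Ventures.PercRepro2

open UnionCluster CovForm

namespace RootLeafU

namespace LSup

variable {V : Type*} {E : Type*} [Fintype E] [DecidableEq E] [Fintype V] [DecidableEq V]
  {R : Type*} [Field R] [LinearOrder R] [IsStrictOrderedRing R]

section PhiLM

variable (p : E → R) (ends : E → Sym2 V) (o a₂ c b u : V) (M : R)

omit [Fintype V] [DecidableEq V] in
/-- **`φ_{L,M}` is antitone along nested clusters of `a₂`**: `φ_{L,M}(K) = g_L(K)` if `c ∈ K`, `M` if `c ∉ K`, under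
`hM : g_L(C(a₂)(ω)) ≤ M` for every configuration with `c ∈ C(a₂)(ω)`. -/
lemma phiLM_clusterAnti (hp : IsProbVec p)
    (hM : ∀ ω : Config E, c ∈ cluster ends ω a₂ →
      delClusterProb p ends u {W : Set V | b ∈ W} (cluster ends ω a₂) ≤ M) :
    ∀ ω ω' : Config E, cluster ends ω a₂ ⊆ cluster ends ω' a₂ →
      (({W : Set V | c ∈ W}).indicator (delClusterProb p ends u {W : Set V | b ∈ W}) (cluster ends ω' a₂) +
        ({W : Set V | c ∉ W}).indicator (fun _ => M) (cluster ends ω' a₂)) ≤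
      (({W : Set V | c ∈ W}).indicator (delClusterProb p ends u {W : Set V | b ∈ W}) (cluster ends ω a₂) +
        ({W : Set V | c ∉ W}).indicator (fun _ => M) (cluster ends ω a₂)) := by
  intro ω ω' h
  have hg := delClusterProb_anti p hp ends u (𝓥 := {W : Set V | b ∈ W}) (fun _ _ h hb => h hb) h
  by_cases hc : c ∈ cluster ends ω a₂
  · have hc' : c ∈ cluster ends ω' a₂ := h hc
    rw [Set.indicator_of_mem (show cluster ends ω a₂ ∈ {W : Set V | c ∈ W} from hc),
      Set.indicator_of_mem (show cluster ends ω' a₂ ∈ {W : Set V | c ∈ W} from hc'),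
      Set.indicator_of_notMem (show cluster ends ω a₂ ∉ {W : Set V | c ∉ W} from fun h' => h' hc),
      Set.indicator_of_notMem (show cluster ends ω' a₂ ∉ {W : Set V | c ∉ W} from fun h' => h' hc')]
    linarith
  · rw [Set.indicator_of_notMem (show cluster ends ω a₂ ∉ {W : Set V | c ∈ W} from hc),
      Set.indicator_of_mem (show cluster ends ω a₂ ∈ {W : Set V | c ∉ W} from hc)]
    by_cases hc' : c ∈ cluster ends ω' a₂
    · rw [Set.indicator_of_mem (show cluster ends ω' a₂ ∈ {W : Set V | c ∈ W} from hc'),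
        Set.indicator_of_notMem (show cluster ends ω' a₂ ∉ {W : Set V | c ∉ W} from fun h' => h' hc')]
      have := hM ω' hc'
      linarith
    · rw [Set.indicator_of_notMem (show cluster ends ω' a₂ ∉ {W : Set V | c ∈ W} from hc'),
        Set.indicator_of_mem (show cluster ends ω' a₂ ∈ {W : Set V | c ∉ W} from hc')]

omit [Fintype V] [DecidableEq V] in
/-- `φ_{L,M} ≥ 0` when `M ≥ 0`. -/
lemma phiLM_nonneg (hp : IsProbVec p) (hM0 : 0 ≤ M) (K : Set V) :
    0 ≤ ({W : Set V | c ∈ W}).indicator (delClusterProb p ends u {W : Set V | b ∈ W}) K +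
        ({W : Set V | c ∉ W}).indicator (fun _ => M) K := by
  refine add_nonneg (Set.indicator_apply_nonneg fun _ => ?_) (Set.indicator_apply_nonneg fun _ => hM0)
  exact delClusterProb_nonneg p hp ends u _ K

omit [LinearOrder R] [IsStrictOrderedRing R] in
/-- **The splitting of `φ_{L,M}(K)·1_R`** (pointwise): `φ_{L,M}(C_{a₂})·1_{u↮{a₂,c}} = 1_{c∈K}·g_L(K)·1_{u↮a₂} + M·1_{PD}`
(`MixL.phiL_mul_R_eq` with `M` in place of `hbL`). -/
lemma phiLM_mul_R_eq (ω : Config E) :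
    (({W : Set V | c ∈ W}).indicator (delClusterProb p ends u {W : Set V | b ∈ W}) (cluster ends ω a₂) +
        ({W : Set V | c ∉ W}).indicator (fun _ => M) (cluster ends ω a₂)) *
      (avoidAll ends u {a₂, c}).indicator 1 ω =
    ({W : Set V | c ∈ W}).indicator (1 : Set V → R) (cluster ends ω a₂) *
        delClusterProb p ends u {W : Set V | b ∈ W} (cluster ends ω a₂) *
        (avoidAll ends a₂ {u}).indicator 1 ω +
      M * (PDEvent ends u a₂ c).indicator 1 ω := by
  have hPD : PDEvent ends u a₂ c = avoidAll ends u {a₂, c} ∩ (connEvent ends a₂ c)ᶜ :=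
    ISplit.PD_eq_R_inter ends u a₂ c
  by_cases hc : Conn ends ω a₂ c
  · have h1 : cluster ends ω a₂ ∈ {W : Set V | c ∈ W} := hc
    have h2 : cluster ends ω a₂ ∉ {W : Set V | c ∉ W} := fun h => h hc
    have h3 : ω ∉ PDEvent ends u a₂ c := by
      rw [hPD]
      exact fun h => h.2 hc
    rw [Set.indicator_of_mem h1, Set.indicator_of_notMem h2, Set.indicator_of_mem h1,
      Set.indicator_of_notMem h3]
    by_cases hR : ω ∈ avoidAll ends u {a₂, c}
    · rw [Set.indicator_of_mem hR, Set.indicator_of_mem ((MixK.mem_R_iff_of_conn ends u c a₂ hc).1 hR)]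
      simp
    · rw [Set.indicator_of_notMem hR,
        Set.indicator_of_notMem (fun h => hR ((MixK.mem_R_iff_of_conn ends u c a₂ hc).2 h))]
      simp
  · have h1 : cluster ends ω a₂ ∉ {W : Set V | c ∈ W} := hc
    have h2 : cluster ends ω a₂ ∈ {W : Set V | c ∉ W} := hc
    rw [Set.indicator_of_notMem h1, Set.indicator_of_mem h2, Set.indicator_of_notMem h1]
    by_cases hR : ω ∈ avoidAll ends u {a₂, c}
    · have h3 : ω ∈ PDEvent ends u a₂ c := by
        rw [hPD]
        exact ⟨hR, hc⟩
      rw [Set.indicator_of_mem hR, Set.indicator_of_mem h3]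
      simp
    · have h3 : ω ∉ PDEvent ends u a₂ c := by
        rw [hPD]
        exact fun h => hR h.1
      rw [Set.indicator_of_notMem hR, Set.indicator_of_notMem h3]
      simp

omit [LinearOrder R] [IsStrictOrderedRing R] in
/-- **The splitting of `1_{o∈L}·φ_{L,M}(K)·1_R`** (pointwise; `MixL.oL_phiL_mul_R_eq` with `M`). -/
lemma oL_phiLM_mul_R_eq (ω : Config E) :
    ({W : Set V | o ∈ W}).indicator (1 : Set V → R) (cluster ends ω u) *
      (({W : Set V | c ∈ W}).indicator (delClusterProb p ends u {W : Set V | b ∈ W}) (cluster ends ω a₂) +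
        ({W : Set V | c ∉ W}).indicator (fun _ => M) (cluster ends ω a₂)) *
      (avoidAll ends u {a₂, c}).indicator 1 ω =
    ({W : Set V | c ∈ W}).indicator (1 : Set V → R) (cluster ends ω a₂) *
        delClusterProb p ends u {W : Set V | b ∈ W} (cluster ends ω a₂) *
        (connEvent ends u o).indicator 1 ω * (avoidAll ends a₂ {u}).indicator 1 ω +
      M * (PDEvent ends u a₂ c ∩ connEvent ends u o).indicator 1 ω := by
  have h := phiLM_mul_R_eq p ends a₂ c b u M ω
  rw [MixK.indicator_mem_cluster_eq ends u o ω]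
  have e : (PDEvent ends u a₂ c ∩ connEvent ends u o).indicator (1 : Config E → R) ω =
      (PDEvent ends u a₂ c).indicator 1 ω * (connEvent ends u o).indicator 1 ω := by
    by_cases h1 : ω ∈ PDEvent ends u a₂ c <;> by_cases h2 : ω ∈ connEvent ends u o <;>
      simp [Set.indicator, h1, h2]
  rw [e]
  calc (connEvent ends u o).indicator (1 : Config E → R) ω *
        (({W : Set V | c ∈ W}).indicator (delClusterProb p ends u {W : Set V | b ∈ W}) (cluster ends ω a₂) +
          ({W : Set V | c ∉ W}).indicator (fun _ => M) (cluster ends ω a₂)) *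
        (avoidAll ends u {a₂, c}).indicator 1 ω
      = (connEvent ends u o).indicator (1 : Config E → R) ω *
        ((({W : Set V | c ∈ W}).indicator (delClusterProb p ends u {W : Set V | b ∈ W}) (cluster ends ω a₂) +
          ({W : Set V | c ∉ W}).indicator (fun _ => M) (cluster ends ω a₂)) *
        (avoidAll ends u {a₂, c}).indicator 1 ω) := by ring
    _ = _ := by rw [h]; ring

/-- **`0 ≤ F1L_M := M·δ + (b)_L`** for every constant `M ≥ 0` dominating `g_L(K) = P_{G∖K}(u ↔ b)` on the clusters
`K = C(a₂) ∋ c`: under `P(· | u ↮ {a₂, c})`, `Cov(1_{o∈L}, P(c ∈ K | L)·(1_{b∈L} − M)) ≥ 0` — the sharp mirror of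
`KSup.F1M_nonneg` (`MixL.J0L_eq`, `MixL.JL_le`, `bhk_cross_functional_avoid_clusterAnti`; no `(c)_L` slack). -/
theorem F1LM_nonneg (hp : IsProbVec p) (hM0 : 0 ≤ M)
    (hM : ∀ ω : Config E, c ∈ cluster ends ω a₂ →
      delClusterProb p ends u {W : Set V | b ∈ W} (cluster ends ω a₂) ≤ M) :
    0 ≤ M * (prob p (TEvent ends u a₂ c) * prob p (PDEvent ends u a₂ c ∩ connEvent ends u o) -
        prob p (PDEvent ends u a₂ c) * prob p (TEvent ends u a₂ c ∩ connEvent ends u o)) +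
      ((prob p (PDEvent ends u a₂ c) + prob p (TEvent ends u a₂ c)) *
          prob p (TEvent ends u a₂ c ∩ (connEvent ends u o ∩ connEvent ends u b)) -
        (prob p (PDEvent ends u a₂ c ∩ connEvent ends u o) + prob p (TEvent ends u a₂ c ∩ connEvent ends u o)) *
          prob p (TEvent ends u a₂ c ∩ connEvent ends u b)) := by
  classical
  have hφanti := phiLM_clusterAnti p ends a₂ c b u M hp hM
  have hφ0 := phiLM_nonneg p ends c b u M hp hM0
  have hF₁ : Monotone (({W : Set V | o ∈ W}).indicator (1 : Set V → R)) :=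
    monotone_indicator_one_of_isUpperSet (fun _ _ h ho => h ho)
  have hF₁0 : ∀ S, 0 ≤ ({W : Set V | o ∈ W}).indicator (1 : Set V → R) S :=
    fun S => Set.indicator_apply_nonneg fun _ => zero_le_one
  have ha : a₂ ∈ ({a₂, c} : Finset V) := by simp
  have key := KSup.bhk_cross_functional_avoid_clusterAnti p ends hp u a₂ ha hF₁ hF₁0 hφanti hφ0
  have e1 : expect p (fun ω => ({W : Set V | o ∈ W}).indicator (1 : Set V → R) (cluster ends ω u) *
      (avoidAll ends u {a₂, c}).indicator 1 ω) =
      prob p (PDEvent ends u a₂ c ∩ connEvent ends u o) +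
        prob p (TEvent ends u a₂ c ∩ connEvent ends u o) := by
    rw [← prob_clusterInEvent_inter_eq_expect, ExploreA3.clusterInEvent_mem_eq, Set.inter_comm,
      ← ISplit.prob_PD_add_T p ends u a₂ c (connEvent ends u o)]
  have e2 : prob p (avoidAll ends u {a₂, c}) =
      prob p (PDEvent ends u a₂ c) + prob p (TEvent ends u a₂ c) := by
    have h := ISplit.prob_PD_add_T p ends u a₂ c Set.univ
    simp only [Set.inter_univ] at h
    exact h.symm
  have e3 : expect p (fun ω =>
      (({W : Set V | c ∈ W}).indicator (delClusterProb p ends u {W : Set V | b ∈ W}) (cluster ends ω a₂) +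
        ({W : Set V | c ∉ W}).indicator (fun _ => M) (cluster ends ω a₂)) *
      (avoidAll ends u {a₂, c}).indicator 1 ω) =
      prob p (TEvent ends u a₂ c ∩ connEvent ends u b) +
        M * prob p (PDEvent ends u a₂ c) := by
    have e : (fun ω =>
        (({W : Set V | c ∈ W}).indicator (delClusterProb p ends u {W : Set V | b ∈ W}) (cluster ends ω a₂) +
          ({W : Set V | c ∉ W}).indicator (fun _ => M) (cluster ends ω a₂)) *
        (avoidAll ends u {a₂, c}).indicator 1 ω) =
        fun ω => ({W : Set V | c ∈ W}).indicator (1 : Set V → R) (cluster ends ω a₂) *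
          delClusterProb p ends u {W : Set V | b ∈ W} (cluster ends ω a₂) *
          (avoidAll ends a₂ {u}).indicator 1 ω +
        M * (PDEvent ends u a₂ c).indicator 1 ω :=
      funext fun ω => phiLM_mul_R_eq p ends a₂ c b u M ω
    rw [e, MixL.expect_add_fun_L p (fun ω => ({W : Set V | c ∈ W}).indicator (1 : Set V → R) (cluster ends ω a₂) *
          delClusterProb p ends u {W : Set V | b ∈ W} (cluster ends ω a₂) *
          (avoidAll ends a₂ {u}).indicator 1 ω)
        (fun ω => M * (PDEvent ends u a₂ c).indicator 1 ω),
      expect_const_mul, ← prob_eq_expect_indicator, MixL.J0L_eq]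
  have e4 : expect p (fun ω => ({W : Set V | o ∈ W}).indicator (1 : Set V → R) (cluster ends ω u) *
      (({W : Set V | c ∈ W}).indicator (delClusterProb p ends u {W : Set V | b ∈ W}) (cluster ends ω a₂) +
        ({W : Set V | c ∉ W}).indicator (fun _ => M) (cluster ends ω a₂)) *
      (avoidAll ends u {a₂, c}).indicator 1 ω) =
      expect p (fun ω => ({W : Set V | c ∈ W}).indicator (1 : Set V → R) (cluster ends ω a₂) *
        delClusterProb p ends u {W : Set V | b ∈ W} (cluster ends ω a₂) *
        (connEvent ends u o).indicator 1 ω * (avoidAll ends a₂ {u}).indicator 1 ω) +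
        M * prob p (PDEvent ends u a₂ c ∩ connEvent ends u o) := by
    have e : (fun ω => ({W : Set V | o ∈ W}).indicator (1 : Set V → R) (cluster ends ω u) *
        (({W : Set V | c ∈ W}).indicator (delClusterProb p ends u {W : Set V | b ∈ W}) (cluster ends ω a₂) +
          ({W : Set V | c ∉ W}).indicator (fun _ => M) (cluster ends ω a₂)) *
        (avoidAll ends u {a₂, c}).indicator 1 ω) =
        fun ω => ({W : Set V | c ∈ W}).indicator (1 : Set V → R) (cluster ends ω a₂) *
          delClusterProb p ends u {W : Set V | b ∈ W} (cluster ends ω a₂) *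
          (connEvent ends u o).indicator 1 ω * (avoidAll ends a₂ {u}).indicator 1 ω +
        M * (PDEvent ends u a₂ c ∩ connEvent ends u o).indicator 1 ω :=
      funext fun ω => oL_phiLM_mul_R_eq p ends o a₂ c b u M ω
    rw [e, MixL.expect_add_fun_L p (fun ω => ({W : Set V | c ∈ W}).indicator (1 : Set V → R) (cluster ends ω a₂) *
          delClusterProb p ends u {W : Set V | b ∈ W} (cluster ends ω a₂) *
          (connEvent ends u o).indicator 1 ω * (avoidAll ends a₂ {u}).indicator 1 ω)
        (fun ω => M * (PDEvent ends u a₂ c ∩ connEvent ends u o).indicator 1 ω),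
      expect_const_mul, ← prob_eq_expect_indicator]
  rw [e1, e2, e3, e4] at key
  have hJ := MixL.JL_le p ends o a₂ c b u hp
  have hP0 : 0 ≤ prob p (PDEvent ends u a₂ c) + prob p (TEvent ends u a₂ c) :=
    add_nonneg (prob_nonneg hp _) (prob_nonneg hp _)
  have key2 := mul_le_mul_of_nonneg_right (add_le_add_right hJ
    (M * prob p (PDEvent ends u a₂ c ∩ connEvent ends u o))) hP0
  nlinarith [key, key2]

end PhiLM

section SlackL

variable (p : E → R) (ends : E → Sym2 V) (o a₂ c b u : V) (M : R)

omit [Fintype V] [DecidableEq V] in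
/-- `g_L(C(a₂)(ω)) ≤ g_L({a₂, c})` whenever `c ∈ C(a₂)(ω)`. -/
lemma delClusterProb_cluster_le_gac (hp : IsProbVec p) (ω : Config E) (hc : c ∈ cluster ends ω a₂) :
    delClusterProb p ends u {W : Set V | b ∈ W} (cluster ends ω a₂) ≤
      delClusterProb p ends u {W : Set V | b ∈ W} ({a₂, c} : Set V) := by
  refine delClusterProb_anti p hp ends u (𝓥 := {W : Set V | b ∈ W}) (fun _ _ h hb => h hb) ?_
  intro x hx
  rcases hx with rfl | hx
  · exact mem_cluster_self ends ω x
  · rw [Set.mem_singleton_iff] at hx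
    rw [hx]
    exact hc

/-- **`W·T2oL ≥ P(R,oL)·(OU) + ((κ − α) − 2β·M)·δ + 2β·(c)_L`** (the `W`-identity with `(b)_L ≥ −M·δ`). -/
theorem W_mul_T2oL_ge (hp : IsProbVec p) (hM0 : 0 ≤ M)
    (hM : ∀ ω : Config E, c ∈ cluster ends ω a₂ →
      delClusterProb p ends u {W : Set V | b ∈ W} (cluster ends ω a₂) ≤ M) :
    (prob p (PDEvent ends u a₂ c ∩ connEvent ends u o) + prob p (TEvent ends u a₂ c ∩ connEvent ends u o)) * (((prob p (PDEvent ends u a₂ c) * prob p (connEvent ends a₂ b) + prob p (avoidAll ends a₂ {c}) * gap p ends u a₂ b) + (prob p Set.univ * EQb3 p ends u a₂ c b + prob p Set.univ * PDb p ends u a₂ c b + prob p (connEvent ends a₂ b) * EQ3 p ends u a₂ c + prob p (connEvent ends a₂ b) * prob p (avoidAll ends a₂ {u}) - (prob p Set.univ - prob p (avoidAll ends a₂ {c})) * gap p ends u a₂ b)) * prob p (PDEvent ends u a₂ c) + 2 * (prob p (PDEvent ends u a₂ c) * prob p (connEvent ends a₂ b) + prob p (avoidAll ends a₂ {c}) *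 gap p ends u a₂ b) * prob p (TEvent ends u a₂ c) + 2 * (prob p Set.univ * prob p (PDEvent ends u a₂ c) + prob p (avoidAll ends a₂ {c}) * prob p (avoidAll ends a₂ {u})) * prob p (TEvent ends u a₂ c ∩ connEvent ends u b) - 2 * (prob p Set.univ * prob p (PDEvent ends u a₂ c) + prob p (avoidAll ends a₂ {c}) * prob p (avoidAll ends a₂ {u})) * (prob p (PDEvent ends u a₂ c ∩ connEvent ends a₂ b) + prob p (TEvent ends u a₂ c ∩ connEvent ends a₂ b))) + (((prob p Set.univ * EQb3 p ends u a₂ c b + prob p Set.univ * PDb p ends u a₂ c b + prob p (connEvent ends a₂ b) * EQ3 p ends u a₂ c + prob p (connEvent ends a₂ b) * prob p (avoidAll ends a₂ {u}) - (prob p Set.univ - prob p (avoidAll ends a₂ {c})) * gap p ends u a₂ b) - (prob p (PDEvent ends u a₂ c) * prob p (connEvent ends a₂ b) + prob p (avoidAll ends a₂ {c}) * gap p ends u a₂ b)) - 2 * (prob p Set.univ * prob p (PDEvent ends u a₂ c) + prob p (avoidAll ends a₂ {c}) * prob p (avoidAll ends a₂ {u})) * M) * (prob p (TEvent ends u a₂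 c) * prob p (PDEvent ends u a₂ c ∩ connEvent ends u o) - prob p (PDEvent ends u a₂ c) * prob p (TEvent ends u a₂ c ∩ connEvent ends u o)) + 2 * (prob p Set.univ * prob p (PDEvent ends u a₂ c) + prob p (avoidAll ends a₂ {c}) * prob p (avoidAll ends a₂ {u})) * ((prob p (PDEvent ends u a₂ c ∩ connEvent ends u o) + prob p (TEvent ends u a₂ c ∩ connEvent ends u o)) * (prob p (PDEvent ends u a₂ c ∩ connEvent ends a₂ b) + prob p (TEvent ends u a₂ c ∩ connEvent ends a₂ b)) - (prob p (PDEvent ends u a₂ c) + prob p (TEvent ends u a₂ c)) * (prob p (PDEvent ends u a₂ c ∩ (connEvent ends u o ∩ connEvent ends a₂ b)) + prob p (TEvent ends u a₂ c ∩ (connEvent ends u o ∩ connEvent ends a₂ b))))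
      ≤ (prob p (PDEvent ends u a₂ c) + prob p (TEvent ends u a₂ c)) * T2oL p ends o a₂ c b u := by
  classical
  have key := LSide.W_mul_T2oL_eq p ends o a₂ c b u
  have hF := F1LM_nonneg p ends o a₂ c b u M hp hM0 hM
  have n_d0 := prob_nonneg hp (avoidAll ends a₂ {c})
  have n_Z := prob_nonneg hp (avoidAll ends a₂ {u})
  have n_D := prob_nonneg hp (PDEvent ends u a₂ c)
  have n_β : 0 ≤ (prob p Set.univ * prob p (PDEvent ends u a₂ c) + prob p (avoidAll ends a₂ {c}) * prob p (avoidAll ends a₂ {u})) := by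
    rw [prob_univ]
    nlinarith [mul_nonneg n_d0 n_Z]
  rw [key]
  nlinarith [mul_nonneg n_β hF]

/-- **THE SLACK CLASS, `o ∈ L` side**: `0 ≤ T2oL` whenever `(2β·M − (κ − α))·δ ≤ P(R,oL)·(OU) + 2β·(c)_L`, for a constant
`M ≥ 0` dominating `g_L(K) = P_{G∖K}(u ↔ b)` on the clusters `K = C(a₂) ∋ c`. -/
theorem T2oL_nonneg_of_slack_class_M (hp : IsProbVec p) (hM0 : 0 ≤ M)
    (hM : ∀ ω : Config E, c ∈ cluster ends ω a₂ →
      delClusterProb p ends u {W : Set V | b ∈ W} (cluster ends ω a₂) ≤ M)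
    (hcls : (2 * (prob p Set.univ * prob p (PDEvent ends u a₂ c) + prob p (avoidAll ends a₂ {c}) * prob p (avoidAll ends a₂ {u})) * M - ((prob p Set.univ * EQb3 p ends u a₂ c b + prob p Set.univ * PDb p ends u a₂ c b + prob p (connEvent ends a₂ b) * EQ3 p ends u a₂ c + prob p (connEvent ends a₂ b) * prob p (avoidAll ends a₂ {u}) - (prob p Set.univ - prob p (avoidAll ends a₂ {c})) * gap p ends u a₂ b) - (prob p (PDEvent ends u a₂ c) * prob p (connEvent ends a₂ b) + prob p (avoidAll ends a₂ {c}) * gap p ends u a₂ b))) * (prob p (TEvent ends u a₂ c) * prob p (PDEvent ends u a₂ c ∩ connEvent ends u o) - prob p (PDEvent ends u a₂ c) * prob p (TEvent ends u a₂ c ∩ connEvent ends u o)) ≤ (prob p (PDEvent ends u a₂ c ∩ connEvent ends u o) + prob p (TEvent ends u a₂ c ∩ connEvent ends u o)) * (((prob p (PDEvent ends u a₂ c) * prob p (connEvent ends a₂ b) + prob p (avoidAll ends a₂ {c}) * gap p ends u a₂ b) + (prob p Set.univ * EQb3 p ends u a₂ c b + prob p Set.univ * PDb p ends u a₂ c b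 + prob p (connEvent ends a₂ b) * EQ3 p ends u a₂ c + prob p (connEvent ends a₂ b) * prob p (avoidAll ends a₂ {u}) - (prob p Set.univ - prob p (avoidAll ends a₂ {c})) * gap p ends u a₂ b)) * prob p (PDEvent ends u a₂ c) + 2 * (prob p (PDEvent ends u a₂ c) * prob p (connEvent ends a₂ b) + prob p (avoidAll ends a₂ {c}) * gap p ends u a₂ b) * prob p (TEvent ends u a₂ c) + 2 * (prob p Set.univ * prob p (PDEvent ends u a₂ c) + prob p (avoidAll ends a₂ {c}) * prob p (avoidAll ends a₂ {u})) * prob p (TEvent ends u a₂ c ∩ connEvent ends u b) - 2 * (prob p Set.univ * prob p (PDEvent ends u a₂ c) + prob p (avoidAll ends a₂ {c}) * prob p (avoidAll ends a₂ {u})) * (prob p (PDEvent ends u a₂ c ∩ connEvent ends a₂ b) + prob p (TEvent ends u a₂ c ∩ connEvent ends a₂ b))) + 2 * (prob p Set.univ * prob p (PDEvent ends u a₂ c) + prob p (avoidAll ends a₂ {c}) * prob p (avoidAll ends a₂ {u})) * ((prob p (PDEvent ends u a₂ c ∩ connEvent ends u o) + prob p (TEvent ends u a₂ c ∩ connEvent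 ends u o)) * (prob p (PDEvent ends u a₂ c ∩ connEvent ends a₂ b) + prob p (TEvent ends u a₂ c ∩ connEvent ends a₂ b)) - (prob p (PDEvent ends u a₂ c) + prob p (TEvent ends u a₂ c)) * (prob p (PDEvent ends u a₂ c ∩ (connEvent ends u o ∩ connEvent ends a₂ b)) + prob p (TEvent ends u a₂ c ∩ (connEvent ends u o ∩ connEvent ends a₂ b))))) :
    0 ≤ T2oL p ends o a₂ c b u := by
  classical
  have hge := W_mul_T2oL_ge p ends o a₂ c b u M hp hM0 hM
  have n_D := prob_nonneg hp (PDEvent ends u a₂ c)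
  have n_t := prob_nonneg hp (TEvent ends u a₂ c)
  rcases eq_or_lt_of_le (add_nonneg n_D n_t) with hW0 | hWpos
  · -- `W = 0`: `D = t = 0`, every `PD`- and `T`-mass vanishes, `T2oL = 0`
    have hD : prob p (PDEvent ends u a₂ c) = 0 := by linarith
    have ht : prob p (TEvent ends u a₂ c) = 0 := by linarith
    have z : ∀ X : Set (Config E), prob p (PDEvent ends u a₂ c ∩ X) = 0 :=
      fun X => le_antisymm (hD ▸ prob_mono hp Set.inter_subset_left) (prob_nonneg hp _)
    have z' : ∀ X : Set (Config E), prob p (TEvent ends u a₂ c ∩ X) = 0 :=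
      fun X => le_antisymm (ht ▸ prob_mono hp Set.inter_subset_left) (prob_nonneg hp _)
    unfold T2oL
    rw [z, z', z', z, z', hD]
    simp
  · have hpos : 0 ≤ (prob p (PDEvent ends u a₂ c) + prob p (TEvent ends u a₂ c)) * T2oL p ends o a₂ c b u := by
      linarith [hge, hcls]
    by_contra hneg
    have := mul_neg_of_pos_of_neg hWpos (not_le.mp hneg)
    linarith

/-- **The slack class with `M = g_L({a₂, c}) = P_{G − {a₂, c}}(u ↔ b)`**. -/
theorem T2oL_nonneg_of_slack_class_gac (hp : IsProbVec p)
    (hcls : (2 * (prob p Set.univ * prob p (PDEvent ends u a₂ c) + prob p (avoidAll ends a₂ {c}) * prob p (avoidAll ends a₂ {u})) * delClusterProb p ends u {W : Set V | b ∈ W} ({a₂, c} : Set V) - ((prob p Set.univ * EQb3 p ends u a₂ c b + prob p Set.univ * PDb p ends u a₂ c b + prob p (connEvent ends a₂ b) * EQ3 p ends u a₂ c + prob p (connEvent ends a₂ b) * prob p (avoidAll ends a₂ {u}) - (prob p Set.univ - prob p (avoidAll ends a₂ {c})) * gap p ends u a₂ b) - (prob p (PDEvent ends u a₂ c) * prob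 p (connEvent ends a₂ b) + prob p (avoidAll ends a₂ {c}) * gap p ends u a₂ b))) * (prob p (TEvent ends u a₂ c) * prob p (PDEvent ends u a₂ c ∩ connEvent ends u o) - prob p (PDEvent ends u a₂ c) * prob p (TEvent ends u a₂ c ∩ connEvent ends u o)) ≤ (prob p (PDEvent ends u a₂ c ∩ connEvent ends u o) + prob p (TEvent ends u a₂ c ∩ connEvent ends u o)) * (((prob p (PDEvent ends u a₂ c) * prob p (connEvent ends a₂ b) + prob p (avoidAll ends a₂ {c}) * gap p ends u a₂ b) + (prob p Set.univ * EQb3 p ends u a₂ c b + prob p Set.univ * PDb p ends u a₂ c b + prob p (connEvent ends a₂ b) * EQ3 p ends u a₂ c + prob p (connEvent ends a₂ b) * prob p (avoidAll ends a₂ {u}) - (prob p Set.univ - prob p (avoidAll ends a₂ {c})) * gap p ends u a₂ b)) * prob p (PDEvent ends u a₂ c) + 2 * (prob p (PDEvent ends u a₂ c) * prob p (connEvent ends a₂ b) + prob p (avoidAll ends a₂ {c}) * gap p ends u a₂ b) * prob p (TEvent ends u a₂ c) + 2 * (prob p Set.univ * prob p (PDEvent ends u a₂ c) + prob p (avoidAll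 ends a₂ {c}) * prob p (avoidAll ends a₂ {u})) * prob p (TEvent ends u a₂ c ∩ connEvent ends u b) - 2 * (prob p Set.univ * prob p (PDEvent ends u a₂ c) + prob p (avoidAll ends a₂ {c}) * prob p (avoidAll ends a₂ {u})) * (prob p (PDEvent ends u a₂ c ∩ connEvent ends a₂ b) + prob p (TEvent ends u a₂ c ∩ connEvent ends a₂ b))) + 2 * (prob p Set.univ * prob p (PDEvent ends u a₂ c) + prob p (avoidAll ends a₂ {c}) * prob p (avoidAll ends a₂ {u})) * ((prob p (PDEvent ends u a₂ c ∩ connEvent ends u o) + prob p (TEvent ends u a₂ c ∩ connEvent ends u o)) * (prob p (PDEvent ends u a₂ c ∩ connEvent ends a₂ b) + prob p (TEvent ends u a₂ c ∩ connEvent ends a₂ b)) - (prob p (PDEvent ends u a₂ c) + prob p (TEvent ends u a₂ c)) * (prob p (PDEvent ends u a₂ c ∩ (connEvent ends u o ∩ connEvent ends a₂ b)) + prob p (TEvent ends u a₂ c ∩ (connEvent ends u o ∩ connEvent ends a₂ b))))) :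
    0 ≤ T2oL p ends o a₂ c b u :=
  T2oL_nonneg_of_slack_class_M p ends o a₂ c b u _ hp (delClusterProb_nonneg p hp ends u _ _)
    (fun ω hc => delClusterProb_cluster_le_gac p ends a₂ c b u hp ω hc) hcls

end SlackL

end LSup

end RootLeafU

end Summit.Ventures.PercRepro2
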